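import Summits.RiemannHypothesis.RiemannHypothesis.Theorems.WeilGroundStateGroundStatesConvergeToXiWeakLimitHarmonic
import Summits.RiemannHypothesis.RiemannHypothesis.Theorems.WeilGroundStateGroundStatesConvergeToXiStubStrongClassPairing
import Summits.RiemannHypothesis.RiemannHypothesis.Theorems.WeilGroundStateGroundStatesConvergeToXiStubGroundStateEulerLagrangeStrong
import Summits.RiemannHypothesis.RiemannHypothesis.Theorems.WeilGroundStateGroundStatesConvergeToXiWeightedL1
import Literature.NumberTheory.LFunctions.WeilGroundState
import Literature.NumberTheory.LFunctions.WeilGroundStateRealZerosProofs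
import Literature.Analysis.Complex.StripResidueFormula
import Mathlib.Analysis.Calculus.IteratedDeriv.Lemmas
import HarnessLib

/-!
# The leakage functional passes to the limit along the minimising sequence
(crux `GroundBarta.GroundBartaFloor`, stmt-RiemannHypothesis-18389; line
`outer_cutoff_harmonic_pairing`, registered stub L `stub_leakageTendsto`)

Let `u` be a ground state of Weil's form on the window `[-a, a]`, `gₙ` an `L²`-normalised sequence
of window test functions with `gₙ → u` in `L²`, and `κ` a kernel of the strong exponential Weil
class (smooth, every derivative `O(e^{-|t|})`).  Then

  `W(gₙ ⋆ κ̃) → W(u ⋆ κ̃)`.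

Proof (the pattern of `stub_groundState_eulerLagrange_strong`, with the strong-class envelope in
place of the compact-support one): `Fₙ = gₙ ⋆ κ̃`, `G = u ⋆ κ̃` are smooth with
`(v ⋆ κ̃)^{(j)} = v ⋆ κ̃^{(j)}` (`scPair_iteratedDeriv_eq`) and
`‖(v ⋆ κ̃^{(j)})(t)‖ ≤ (max C_j 0 · ∫‖v‖e^{|s|}) e^{-|t|}` (`scPair_norm_weilConv_le`); the weighted
norms `∫‖gₙ‖e^{|s|}` converge (`tendsto_integral_norm_mul_exp_of_minimizingSeq`), hence are
bounded, which gives a COMMON envelope `C e^{-|t|}` on `Fₙ, Fₙ', Fₙ''`; pointwise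
`Fₙ(x) = ⟨gₙ, κ(· - x)⟩ → ⟨u, κ(· - x)⟩ = G(x)` (`L²` pairing with the square-integrable translate);
conclude with dominated convergence of the Weil functional on the exponential class
(`tendsto_weilFunctional_of_dominated`).  RH-free; elementary given the tree. [folklore]
-/

set_option linter.dupNamespace false

noncomputable section

open Set MeasureTheory Filter Complex
open scoped Real Topology ComplexConjugate

namespace Summit.RiemannHypothesis.RiemannHypothesis.Theorems.GroundBartaFloor

open Literature.NumberTheory.LFunctions
open Summit.RiemannHypothesis.RiemannHypothesis.Theorems.GroundStatesConvergeToXi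

/-! ## The reflected kernel -/

/-- The reflection `κ̃` of a strong-class kernel: smooth, all derivatives `O(e^{-|t|})`, hence all
derivatives bounded. [folklore] -/
theorem leakTendsto_reflect_class {κ : ℝ → ℂ} (hκ : ContDiff ℝ (⊤ : ℕ∞) κ)
    (hκb : ∀ k : ℕ, ∃ C : ℝ, ∀ t : ℝ, ‖iteratedDeriv k κ t‖ ≤ C * Real.exp (-(1 * |t|))) :
    ContDiff ℝ (⊤ : ℕ∞) (weilReflect κ) ∧
      (∀ k : ℕ, ∃ C : ℝ, 0 ≤ C ∧ ∀ t : ℝ,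
        ‖iteratedDeriv k (weilReflect κ) t‖ ≤ C * Real.exp (-(1 * |t|))) ∧
      ∀ k : ℕ, ∃ B : ℝ, ∀ t : ℝ, ‖iteratedDeriv k (weilReflect κ) t‖ ≤ B := by
  have hrb : ∀ k : ℕ, ∃ C : ℝ, 0 ≤ C ∧ ∀ t : ℝ,
      ‖iteratedDeriv k (weilReflect κ) t‖ ≤ C * Real.exp (-(1 * |t|)) := by
    intro k
    obtain ⟨C, hC⟩ := hκb k
    refine ⟨max C 0, le_max_right _ _, fun t => ?_⟩
    rw [scPair_norm_iteratedDeriv_weilReflect]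
    have h := hC (-t)
    rw [abs_neg] at h
    exact h.trans (mul_le_mul_of_nonneg_right (le_max_left _ _) (Real.exp_pos _).le)
  refine ⟨scPair_contDiff_weilReflect hκ, hrb, fun k => ?_⟩
  obtain ⟨C, hC0, hC⟩ := hrb k
  refine ⟨C, fun t => (hC t).trans ?_⟩
  refine mul_le_of_le_one_right hC0 (Real.exp_le_one_iff.2 ?_)
  exact neg_nonpos.2 (mul_nonneg zero_le_one (abs_nonneg t))

/-! ## Square-integrability of the translates of the kernel -/

/-- A continuous function with `‖κ t‖ ≤ C e^{-|t|}` has square-integrable translates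
`t ↦ κ (t - x)`. [folklore] -/
theorem leakTendsto_memLp_translate {κ : ℝ → ℂ} (hκc : Continuous κ) {C : ℝ}
    (hC : ∀ t : ℝ, ‖κ t‖ ≤ C * Real.exp (-(1 * |t|))) (x : ℝ) :
    MemLp (fun t : ℝ => κ (t - x)) 2 := by
  have hcont : Continuous fun t : ℝ => κ (t - x) := hκc.comp (continuous_id.sub continuous_const)
  rw [memLp_two_iff_integrable_sq_norm hcont.aestronglyMeasurable]
  have hC0 : 0 ≤ C := by
    have h := hC 0
    have : (0 : ℝ) ≤ C * Real.exp (-(1 * |(0 : ℝ)|)) := (norm_nonneg _).trans h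
    simpa using this
  set K : ℝ := (C * Real.exp (1 * |x|)) ^ 2 with hK
  refine ((Literature.Analysis.Complex.integrable_exp_neg_mul_abs (by norm_num : (0 : ℝ) < 2)).const_mul
    K).mono' (hcont.norm.pow 2).aestronglyMeasurable (ae_of_all _ fun t => ?_)
  rw [Real.norm_eq_abs, abs_of_nonneg (by positivity)]
  have h1 : ‖κ (t - x)‖ ≤ C * Real.exp (1 * |x|) * Real.exp (-(1 * |t|)) := by
    refine (hC (t - x)).trans ?_
    rw [mul_assoc, ← Real.exp_add]
    refine mul_le_mul_of_nonneg_left (Real.exp_le_exp.2 ?_) hC0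
    have := abs_sub_abs_le_abs_sub t x
    linarith
  have h2 : 0 ≤ C * Real.exp (1 * |x|) * Real.exp (-(1 * |t|)) := by positivity
  calc ‖κ (t - x)‖ ^ 2 ≤ (C * Real.exp (1 * |x|) * Real.exp (-(1 * |t|))) ^ 2 :=
        pow_le_pow_left₀ (norm_nonneg _) h1 2
    _ = K * Real.exp (-2 * |t|) := by
        rw [hK, mul_pow, sq (Real.exp (-(1 * |t|))), ← Real.exp_add]
        congr 1
        congr 1
        ring

/-- Pointwise convergence of the pairings: `(gₙ ⋆ κ̃)(x) = ⟨gₙ, κ(· - x)⟩ → ⟨u, κ(· - x)⟩`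
along an `L²`-convergent sequence. [folklore] -/
theorem leakTendsto_pointwise {u : ℝ → ℂ} {g : ℕ → ℝ → ℂ} {κ : ℝ → ℂ}
    (hgm : ∀ n, MemLp (g n) 2) (hu : MemLp u 2)
    (hL : Tendsto (fun n => ∫ t, ‖g n t - u t‖ ^ 2) atTop (𝓝 0)) (hκc : Continuous κ) {C : ℝ}
    (hC : ∀ t : ℝ, ‖κ t‖ ≤ C * Real.exp (-(1 * |t|))) (x : ℝ) :
    Tendsto (fun n => weilConv (g n) (weilReflect κ) x) atTop
      (𝓝 (weilConv u (weilReflect κ) x)) := by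
  have key := ConnesVanSuijlekom.tendsto_integral_mul_conj_left
    (leakTendsto_memLp_translate hκc hC x) hu hgm hL
  simp only [weilConv_weilReflect_apply_eq_integral_mul_conj]
  exact key

/-! ## The stub -/

/-- **Stub L — the leakage functional passes to the limit along the minimising sequence.**
`W(gₙ ⋆ κ̃) → W(u ⋆ κ̃)` for `κ` in the exponential class (`tendsto_weilFunctional_of_dominated`
with the uniform envelopes of `scPair_norm_weilConv_le` / `scPair_iteratedDeriv_eq` and
`tendsto_integral_norm_mul_exp_of_minimizingSeq`; pointwise convergence by the `L²` pairing with the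
translates `κ(· - x)`). [folklore] -/
theorem stub_leakageTendsto :
    ∀ (a : ℝ) (u : ℝ → ℂ) (g : ℕ → ℝ → ℂ) (κ : ℝ → ℂ), IsWeilGroundState a u →
      (∀ n, IsWeilTest (g n) ∧ tsupport (g n) ⊆ Icc (-a) a ∧ ∫ t, ‖g n t‖ ^ 2 = (1 : ℝ)) →
      Tendsto (fun n => ∫ t, ‖g n t - u t‖ ^ 2) atTop (𝓝 0) →
      ContDiff ℝ (⊤ : ℕ∞) κ →
      (∀ k : ℕ, ∃ C : ℝ, ∀ t : ℝ, ‖iteratedDeriv k κ t‖ ≤ C * Real.exp (-(1 * |t|))) →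
      Tendsto (fun n => weilFunctional (weilConv (g n) (weilReflect κ))) atTop
        (𝓝 (weilFunctional (weilConv u (weilReflect κ)))) := by
  intro a u g κ hu hg hL hκ hκb
  obtain ⟨hrc, hrb, hrbdd⟩ := leakTendsto_reflect_class hκ hκb
  -- notation
  set F : ℕ → ℝ → ℂ := fun n => weilConv (g n) (weilReflect κ) with hF
  set G : ℝ → ℂ := weilConv u (weilReflect κ) with hG
  -- weighted-`L¹` data
  have hu2 : MemLp u 2 := hu.memLp
  have hgm : ∀ n, MemLp (g n) 2 := fun n => ConnesVanSuijlekom.isWeilTest_memLp (hg n).1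
  have hgi1 : ∀ n, Integrable (g n) := fun n =>
    (hg n).1.1.continuous.integrable_of_hasCompactSupport (hg n).1.2
  have hgi : ∀ n, Integrable (fun t : ℝ => ‖g n t‖ * Real.exp (1 * |t|)) := fun n =>
    integrable_norm_mul_exp_of_isWeilTest (hg n).1 1
  have hui1 : Integrable u := hu.integrable
  -- a uniform bound `∫ ‖gₙ‖ e^{|t|} ≤ B`
  obtain ⟨B, hB⟩ := (tendsto_integral_norm_mul_exp_of_minimizingSeq hu hg hL 1).bddAbove_range
  have hBn : ∀ n, (∫ t, ‖g n t‖ * Real.exp (1 * |t|)) ≤ B := fun n => hB ⟨n, rfl⟩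
  have hB0 : 0 ≤ B := (integral_nonneg fun t => by positivity).trans (hBn 0)
  -- envelopes of the reflected kernel at orders 0, 1, 2
  obtain ⟨C₀, hC₀0, hC₀⟩ := hrb 0
  obtain ⟨C₁, hC₁0, hC₁⟩ := hrb 1
  obtain ⟨C₂, hC₂0, hC₂⟩ := hrb 2
  set C : ℝ := max C₀ (max C₁ C₂) * B with hC
  -- the generic envelope of `gₙ ⋆ κ̃^{(j)}`
  have henv : ∀ (j : ℕ) (Cj : ℝ), 0 ≤ Cj → Cj ≤ max C₀ (max C₁ C₂) →
      (∀ t, ‖iteratedDeriv j (weilReflect κ) t‖ ≤ Cj * Real.exp (-(1 * |t|))) →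
      ∀ n t, ‖iteratedDeriv j (F n) t‖ ≤ C * Real.exp (-(1 * |t|)) := by
    intro j Cj hCj0 hCjle hCj n t
    rw [hF]
    dsimp only
    rw [scPair_iteratedDeriv_eq (hgi1 n) hrc hrbdd j]
    have h1 := scPair_norm_weilConv_le (v := g n) (k := iteratedDeriv j (weilReflect κ))
      (hgi n) zero_le_one le_rfl hCj t
    rw [max_eq_left hCj0] at h1
    refine h1.trans (mul_le_mul_of_nonneg_right ?_ (Real.exp_pos _).le)
    rw [hC]
    exact mul_le_mul hCjle (hBn n) (integral_nonneg fun s => by positivity)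
      (hCj0.trans hCjle)
  have hFs : ∀ n, ContDiff ℝ (⊤ : ℕ∞) (F n) := fun n => scPair_contDiff (hgi1 n) hrc hrbdd
  have hF0 : ∀ n t, ‖F n t‖ ≤ C * Real.exp (-(1 * |t|)) := fun n t => by
    have h := henv 0 C₀ hC₀0 (le_max_left _ _) hC₀ n t
    rwa [iteratedDeriv_zero] at h
  have hF1 : ∀ n t, ‖deriv (F n) t‖ ≤ C * Real.exp (-(1 * |t|)) := fun n t => by
    have h := henv 1 C₁ hC₁0 ((le_max_left _ _).trans (le_max_right _ _)) hC₁ n t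
    rwa [iteratedDeriv_one] at h
  have hF2 : ∀ n t, ‖deriv (deriv (F n)) t‖ ≤ C * Real.exp (-(1 * |t|)) := fun n t => by
    have h := henv 2 C₂ hC₂0 ((le_max_right _ _).trans (le_max_right _ _)) hC₂ n t
    rwa [iteratedDeriv_succ, iteratedDeriv_one] at h
  -- `G` is continuous (even smooth)
  have hGc : Continuous G := (scPair_contDiff hui1 hrc hrbdd).continuous
  -- pointwise convergence
  obtain ⟨K, hK⟩ := hκb 0
  have hK' : ∀ t : ℝ, ‖κ t‖ ≤ K * Real.exp (-(1 * |t|)) := fun t => by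
    simpa only [iteratedDeriv_zero] using hK t
  have hpt : ∀ t, Tendsto (fun n => F n t) atTop (𝓝 (G t)) := fun t =>
    leakTendsto_pointwise hgm hu2 hL hκ.continuous hK' t
  exact tendsto_weilFunctional_of_dominated (by norm_num : (1 : ℝ) / 2 < 1) hFs hGc hF0 hF1 hF2 hpt

end Summit.RiemannHypothesis.RiemannHypothesis.Theorems.GroundBartaFloor

end
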